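import Mathlib
import Summits.ResolutionOfSingularities.ResolutionOfSingularities.Theorems.WeightedInvariantLocalWeightedDropTOT2NearDir

/-!
# `WeightedInvariant.LocalWeightedDrop`, TOT₂ line (skeleton v32, residual `stub_spaceNCRankDrop`), piece S-NEAR part 4:
# THE DIRECTRIX OF A NON-CONSTANT FORM IS A PROPER SUBSPACE — `e ≤ n` in `n + 1` letters; `hone` is automatic in two letters,
# `htwo` in three (every field with infinitely many elements)

Crux item stmt-ResolutionOfSingularities-8899 `LocalWeightedDrop`; sub-line TOT2-LINE v1/v1.1 (`L/res-L1-w43-lead-1/g4/TOT2-LINE.md`) §4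
(«e = 3 does not occur for a non-constant form in three letters»).  [OURS · L1 W4.3, chain w43, res-L1-w43-stub-3 (gen 4) = S-NEAR hand.
MODEL: Cossart–Jannsen–Saito, LNM 2270, `e_x(X) ≤ dim X` (Def. 2.? / before Thm 2.6; corpus p0034).  AI-written; gate-accepted means sorry-free
with standard axioms, not refereed.  Def-free.]

VOCABULARY as in parts 1–3: `in_o f := v ↦ CobordantChart.initEval 1 v o f`; invariance vector `u`: `∀ v, in_o f (v + u) = in_o f (v)`.
* `initEval_zero_of_pos` — `in_o f (0) = 0` for `o > 0`.
* `initEval_eq_zero_of_forall_inv`, `coeff_eq_zero_of_forall_inv` — if EVERY vector is an invariance vector (`o > 0`), the form vanishes as a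
  function, hence (infinite field, `MvPolynomial.funext`) all degree-`o` coefficients of `f` vanish; `order_ne_of_forall_inv` — so `o ≠ ord f`.
* **`not_linearIndependent_of_inv`** — for `f ≠ 0` of order `o > 0` in `N` letters, NO `N` invariance vectors of `in_o f` are linearly independent
  (`e < N`).
* **`hone_of_two`** — two letters: every two invariance vectors are dependent (the binder `hone` of the engine holds for every plane germ);
  **`htwo_of_three`** — three letters: every three invariance vectors are dependent (the binder `htwo` of part 3's `near_dependent_of_apexPlane_curve`).
-/

set_option linter.dupNamespace false -- mandated namespace of this single-conjunct summit
set_option autoImplicit false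

namespace Summit.ResolutionOfSingularities.ResolutionOfSingularities.Theorems

namespace TOT2Near

open MvPowerSeries Literature.AlgebraicGeometry.Resolution

variable {k : Type} [Field k] {N : ℕ}

/-! ## §1 The form vanishes at the origin; all-invariant forms vanish -/

/-- The degree-`o` form vanishes at the origin when `o > 0`. -/
theorem initEval_zero_of_pos {o : ℕ} (ho : 0 < o) (f : MvPowerSeries (Fin N) k) :
    CobordantChart.initEval (fun _ : Fin N => 1) 0 o f = 0 := by
  classical
  rw [ApexFreeOrderDrop.initEval_one_eq_sum]
  refine Finset.sum_eq_zero fun e he => ?_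
  rw [ApexFreeOrderDrop.mem_antidiag_iff, ApexFreeOrderDrop.weight_one_eq_degree] at he
  have hne : e ≠ 0 := by
    rintro rfl
    rw [map_zero] at he
    omega
  have hl : ∃ l, e l ≠ 0 := by
    by_contra h
    push Not at h
    exact hne (Finsupp.ext h)
  obtain ⟨l, hl⟩ := hl
  rw [Finset.prod_eq_zero (Finset.mem_univ l) (by rw [Pi.zero_apply, zero_pow hl]), mul_zero]

/-- If EVERY vector is an invariance vector of the degree-`o` form (`o > 0`), the form vanishes identically as a function. -/
theorem initEval_eq_zero_of_forall_inv {o : ℕ} (ho : 0 < o) {f : MvPowerSeries (Fin N) k}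
    (h : ∀ u v : Fin N → k,
      CobordantChart.initEval (fun _ : Fin N => 1) (v + u) o f = CobordantChart.initEval (fun _ : Fin N => 1) v o f)
    (v : Fin N → k) : CobordantChart.initEval (fun _ : Fin N => 1) v o f = 0 := by
  have h1 := h v 0
  rwa [zero_add, initEval_zero_of_pos ho] at h1

/-- … hence, over a field with infinitely many elements, all degree-`o` coefficients of `f` vanish (`MvPolynomial.funext` on the initial form). -/
theorem coeff_eq_zero_of_forall_inv [Infinite k] {o : ℕ} (ho : 0 < o) {f : MvPowerSeries (Fin N) k}
    (h : ∀ u v : Fin N → k,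
      CobordantChart.initEval (fun _ : Fin N => 1) (v + u) o f = CobordantChart.initEval (fun _ : Fin N => 1) v o f)
    {e : Fin N →₀ ℕ} (he : e.degree = o) : coeff e f = 0 := by
  classical
  have hP : (∑ d ∈ (Finset.univ : Finset (Fin N)).finsuppAntidiag o,
      MvPolynomial.monomial d (coeff d f) : MvPolynomial (Fin N) k) = 0 :=
    MvPolynomial.funext fun v => by
      rw [ApexFreeOrderDrop.eval_initForm, initEval_eq_zero_of_forall_inv ho h v, map_zero]
  have hc := congr_arg (MvPolynomial.coeff e) hP
  rw [ApexFreeOrderDrop.coeff_initForm, if_pos (by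
    rw [ApexFreeOrderDrop.mem_antidiag_iff, ApexFreeOrderDrop.weight_one_eq_degree, he]), MvPolynomial.coeff_zero] at hc
  exact hc

/-- … so `ord f ≠ o` (`o > 0`) if every vector is an invariance vector of `in_o f`: a germ of positive finite order has SOME non-invariance vector. -/
theorem order_ne_of_forall_inv [Infinite k] {o : ℕ} (ho : 0 < o) {f : MvPowerSeries (Fin N) k}
    (h : ∀ u v : Fin N → k,
      CobordantChart.initEval (fun _ : Fin N => 1) (v + u) o f = CobordantChart.initEval (fun _ : Fin N => 1) v o f) :
    f.order ≠ o := by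
  intro hord
  have hfin : f.order.toNat = f.order := by rw [hord]; rfl
  obtain ⟨d, hd, hdeg⟩ := exists_coeff_ne_zero_and_order hfin
  rw [hord] at hdeg
  exact hd (coeff_eq_zero_of_forall_inv ho h (by exact_mod_cast hdeg))

/-! ## §2 `e < N`: no `N` independent invariance vectors in `N` letters -/

/-- **THE DIRECTRIX OF A NON-CONSTANT FORM IS A PROPER SUBSPACE** (`e_x ≤ dim X` for a hypersurface): for `f ≠ 0` of order `o > 0` in `N`
letters over a field with infinitely many elements, no family of `N` translation-invariance vectors of the degree-`o` form is linearly
independent (else they span, invariance vectors form a subspace (`inv_add`, `inv_smul`), every vector is one, and the form vanishes). -/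
theorem not_linearIndependent_of_inv [Infinite k] {o : ℕ} (ho : 0 < o) {f : MvPowerSeries (Fin N) k} (hord : f.order = o)
    (u : Fin N → (Fin N → k))
    (hu : ∀ i v, CobordantChart.initEval (fun _ : Fin N => 1) (v + u i) o f = CobordantChart.initEval (fun _ : Fin N => 1) v o f) :
    ¬ LinearIndependent k u := by
  intro hli
  -- the invariance vectors form a subspace containing the `u i`, hence everything
  let S : Submodule k (Fin N → k) :=
    { carrier := {x | ∀ v, CobordantChart.initEval (fun _ : Fin N => 1) (v + x) o f =
        CobordantChart.initEval (fun _ : Fin N => 1) v o f}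
      add_mem' := fun ha hb => inv_add ha hb
      zero_mem' := fun v => by rw [add_zero]
      smul_mem' := fun t x hx => inv_smul hx t }
  have hspan : Submodule.span k (Set.range u) = ⊤ :=
    hli.span_eq_top_of_card_eq_finrank' (by rw [Fintype.card_fin, Module.finrank_fin_fun])
  have hle : Submodule.span k (Set.range u) ≤ S := Submodule.span_le.mpr (by
    rintro _ ⟨i, rfl⟩
    exact hu i)
  have hall : ∀ x v : Fin N → k, CobordantChart.initEval (fun _ : Fin N => 1) (v + x) o f =
      CobordantChart.initEval (fun _ : Fin N => 1) v o f := fun x => hle (by rw [hspan]; exact Submodule.mem_top)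
  exact order_ne_of_forall_inv ho hall hord

/-! ## §3 Two and three letters: the engine's binders `hone` / `htwo` for free -/

/-- **TWO LETTERS: `hone` IS AUTOMATIC** — for a non-zero plane germ of positive order `o`, every two invariance vectors of its degree-`o` form
are linearly dependent (`e ≤ 1`). -/
theorem hone_of_two [Infinite k] {o : ℕ} (ho : 0 < o) {f : MvPowerSeries (Fin 2) k} (hord : f.order = o)
    (u₁ u₂ : Fin 2 → k)
    (h₁ : ∀ v, CobordantChart.initEval (fun _ : Fin 2 => 1) (v + u₁) o f = CobordantChart.initEval (fun _ : Fin 2 => 1) v o f)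
    (h₂ : ∀ v, CobordantChart.initEval (fun _ : Fin 2 => 1) (v + u₂) o f = CobordantChart.initEval (fun _ : Fin 2 => 1) v o f) :
    ∃ α β : k, (α ≠ 0 ∨ β ≠ 0) ∧ α • u₁ + β • u₂ = 0 := by
  have h := not_linearIndependent_of_inv ho hord ![u₁, u₂] (fun i => by fin_cases i <;> assumption)
  rw [Fintype.not_linearIndependent_iff] at h
  obtain ⟨g, hg, i, hi⟩ := h
  refine ⟨g 0, g 1, ?_, ?_⟩
  · fin_cases i
    · exact Or.inl hi
    · exact Or.inr hi
  · simpa [Fin.sum_univ_two] using hg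

/-- **THREE LETTERS: `htwo` IS AUTOMATIC** — for a non-zero surface germ of positive order `o`, every three invariance vectors of its
degree-`o` form are linearly dependent (`e ≤ 2`; the hypothesis `htwo` of part 3's `near_dependent_of_apexPlane_curve`). -/
theorem htwo_of_three [Infinite k] {o : ℕ} (ho : 0 < o) {f : MvPowerSeries (Fin 3) k} (hord : f.order = o)
    (u₁ u₂ u₃ : Fin 3 → k)
    (h₁ : ∀ v, CobordantChart.initEval (fun _ : Fin 3 => 1) (v + u₁) o f = CobordantChart.initEval (fun _ : Fin 3 => 1) v o f)
    (h₂ : ∀ v, CobordantChart.initEval (fun _ : Fin 3 => 1) (v + u₂) o f = CobordantChart.initEval (fun _ : Fin 3 => 1) v o f)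
    (h₃ : ∀ v, CobordantChart.initEval (fun _ : Fin 3 => 1) (v + u₃) o f = CobordantChart.initEval (fun _ : Fin 3 => 1) v o f) :
    ∃ α β γ : k, (α ≠ 0 ∨ β ≠ 0 ∨ γ ≠ 0) ∧ α • u₁ + β • u₂ + γ • u₃ = 0 := by
  have h := not_linearIndependent_of_inv ho hord ![u₁, u₂, u₃] (fun i => by fin_cases i <;> assumption)
  rw [Fintype.not_linearIndependent_iff] at h
  obtain ⟨g, hg, i, hi⟩ := h
  refine ⟨g 0, g 1, g 2, ?_, ?_⟩
  · fin_cases i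
    · exact Or.inl hi
    · exact Or.inr (Or.inl hi)
    · exact Or.inr (Or.inr hi)
  · simpa [Fin.sum_univ_three] using hg

end TOT2Near

end Summit.ResolutionOfSingularities.ResolutionOfSingularities.Theorems
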